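import Summits.BirchSwinnertonDyer.Rank1Residual.P2.CongruentNumberSilentEvenFiveSelmerEight
import HarnessLib

/-!
# Cell `bsd-monsky`: `s(2pq) = 1` on the WHOLE even-five two-prime family (both symbol halves) and the
# `𝒮⁺` door `BSD(E_{2pq}, 2)` with Monsky's EVEN formula (`hMe`) in place of Monsky 1990 Cor 5.15 (`h515`)
# — so that no theorem of the even-five family carries a Monsky 1990 binder (nothing asserted)

HONEST FRAMING (cell `bsd-monsky`, run/shared/lean/pub/bsd-monsky/, README §1: ONE theorem on ONE
explicit infinite family of quadratic twists of the congruent number curve at the prime `2`; not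
"BSD for rank ≤ 1", nothing at odd primes, nothing booked until the cross-family referee passes the
written proof). This file asserts NO arithmetic fact. It is the `(p/q) = +1` companion of
`P2/CongruentNumberSilentEvenFiveSelmerEight.lean`:

* §1 Monsky's even matrix on `2pq`, `p ≡ 5 (mod 8)`, `q ≡ 3 (mod 4)`, `(p/q) = +1` (hence `(q/p) = +1`,
  so the symbol block `A` vanishes): `M = ( D₂  D₋₁ ; D₂  D₂ )` has a `2`-element kernel in both residue
  cases (`decide`), i.e. `s(2pq) = 1`; together with the `(p/q) = −1` half this gives `#Sel₂(E_{2pq}) = 8`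
  for EVERY `p ≡ 5 (mod 8)`, `q ≡ 3 (mod 4)` from `hMe` alone (`card_selmerGroup_two_two_mul_five_mul_any`);
* §2 the landed `𝒮⁺` theorem `P2.bsdp_two_congruentNumberCurve_two_mul_five_mul` (binders `hTYZ`, `hGZK`,
  `hR`, `h515`) re-proved with `hMe` in place of `h515`: rank `1` from `hGZK` (already a binder there),
  `#Sel₂ = 8` from §1, `Ш[2^∞] = 0` from the descent count, the fact-free door
  `bsdp_two_congruentNumberCurve_iff_of_rank_one_of_sha_two_eq_bot`;
* §3 the `h515`-free twin of `Conjectures.forall_bsdp_two_congruentNumberCurve_two_mul_five_mul_of_conjecture`: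
  `BSD(E_{2pq}, 2)` on BOTH halves, modulo `{hTYZ, hGZK, hR, hMe}` and the conjecture
  `CongruentSilentEvenFiveBSDTwo` as a HYPOTHESIS (the conjecture is not asserted).

With the sequel `P2/CongruentNumberSilentEvenFiveDatumMonskyEven.lean` (datum ⟹ C-P2-1 modulo `hMe`)
the whole even-five two-prime family is then conditional on `{hTYZ, hGZK, hR, hMe, datum}` — Heath-Brown
1994's appendix is the only `2`-Selmer input, exactly as in the written proof of record. Nothing asserted,
no mark moved.

References: [HeathBrown1994SelmerCongruentII] §1 (typescript p. 1 L14–L20), Appendix (Monsky) p. 41 L20–L36;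
[TianYuanZhang2017] Thm. 1.2, Thm. 3.5, §1 (1.1); [SilvermanAEC2009] Thm. X.4.2; [IrelandRosen1990] Ch. 5 §2;
[Miller2011LMS] Def. 1.1; [Monsky1990MockHeegner] Cor. 5.15 (2′) (p. 66) — the fact NOT used here.
-/

noncomputable section

open scoped Classical

open WeierstrassCurve Literature.NumberTheory.EllipticCurves
  Literature.NumberTheory.EllipticCurves.Rank1Residual
  Literature.NumberTheory.EllipticCurves.Rank1Residual.Typed
  Literature.NumberTheory.EllipticCurves.HeathBrown1994
  Literature.NumberTheory.EllipticCurves.HeathBrown1994.Families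
  Literature.NumberTheory.EllipticCurves.Monsky1990
  Literature.NumberTheory.EllipticCurves.TianYuanZhang2017
  Literature.NumberTheory.QuadraticFields.RedeiReichardt

set_option autoImplicit false

namespace Summit.BirchSwinnertonDyer.Rank1Residual.P2

open Conjectures

/-! ## §1 Monsky's even matrix on the `(p/q) = +1` half: `#ker M = 2`, `s(2pq) = 1`; both halves -/

section PlusMatrix

variable {p q : ℕ}

/-- On the `(p/q) = +1` half, `(q/p) = +1` too (quadratic reciprocity, `p ≡ 1 (mod 4)`).
[cite: IrelandRosen1990, Ch. 5 §2 Thm. 1 (reciprocity for the Jacobi symbol)] -/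
theorem jacobiSym_swap_two_mul_five_mul_plus (hq : q.Prime) (hp4 : p % 4 = 1) (hq2 : q ≠ 2)
    (hpq : jacobiSym (p : ℤ) q = 1) : jacobiSym (q : ℤ) p = 1 := by
  rw [jacobiSym.quadratic_reciprocity_one_mod_four' (hq.odd_of_ne_two hq2) hp4, hpq]

/-- **Monsky's even matrix, `(p/q) = +1`, `q ≡ 3 (mod 8)`**: `A = 0`, `D₂ = I`, `D₋₁ = diag(0, 1)`:
`M = ( D₂  D₋₁ ; D₂  D₂ ) = ( 1 0 0 0 ; 0 1 0 1 ; 1 0 1 0 ; 0 1 0 1 )`.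
[cite: HeathBrown1994SelmerCongruentII, Appendix (Monsky), typescript p. 41 L20–L36 (the matrix; evaluation ours)] -/
theorem monskyMatrixEven_two_mul_five_three_plus (hp : p.Prime) (hq : q.Prime) (hp8 : p % 8 = 5)
    (hq8 : q % 8 = 3) (hpq : jacobiSym (p : ℤ) q = 1) :
    monskyMatrixEven ![p, q] = (Matrix.fromBlocks !![1, 0; 0, 1] !![0, 0; 0, 1] !![1, 0; 0, 1]
      !![1, 0; 0, 1] : Matrix (Fin 2 ⊕ Fin 2) (Fin 2 ⊕ Fin 2) (ZMod 2)) := by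
  have h3 : jacobiSym 2 p = -1 := jacobiSym_two_eq_neg_one (Or.inr hp8)
  have h4 : jacobiSym (-1) p = 1 := jacobiSym_neg_one_eq_one (by omega)
  have h5 : jacobiSym 2 q = -1 := jacobiSym_two_eq_neg_one (Or.inl hq8)
  have h6 : jacobiSym (-1) q = -1 := DeuringLadic.jacobiSym_neg_one_of_mod_four (by omega)
  have h7 : jacobiSym (p : ℤ) p = 0 := Families.jacobiSym_self hp.one_lt
  have h8 : jacobiSym (q : ℤ) q = 0 := Families.jacobiSym_self hq.one_lt
  have h1 : jacobiSym (q : ℤ) p = 1 :=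
    jacobiSym_swap_two_mul_five_mul_plus hq (by omega) (by omega) hpq
  ext i j
  rcases i with i | i <;> rcases j with j | j <;> fin_cases i <;> fin_cases j <;>
    (simp [monskyMatrixEven, legendreMatrix, legendreDiagonal, addLegendreSym, Matrix.fromBlocks,
      Matrix.diagonal, Matrix.transpose, Finset.sum_erase_eq_sub, Fin.sum_univ_succ, h1, hpq, h3, h4,
      h5, h6, h7, h8]; try decide)

/-- **Monsky's even matrix, `(p/q) = +1`, `q ≡ 7 (mod 8)`**: `A = 0`, `D₂ = diag(1, 0)`, `D₋₁ = diag(0, 1)`: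
`M = ( 1 0 0 0 ; 0 0 0 1 ; 1 0 1 0 ; 0 0 0 0 )`.
[cite: HeathBrown1994SelmerCongruentII, Appendix (Monsky), typescript p. 41 L20–L36 (the matrix; evaluation ours)] -/
theorem monskyMatrixEven_two_mul_five_seven_plus (hp : p.Prime) (hq : q.Prime) (hp8 : p % 8 = 5)
    (hq8 : q % 8 = 7) (hpq : jacobiSym (p : ℤ) q = 1) :
    monskyMatrixEven ![p, q] = (Matrix.fromBlocks !![1, 0; 0, 0] !![0, 0; 0, 1] !![1, 0; 0, 0]
      !![1, 0; 0, 0] : Matrix (Fin 2 ⊕ Fin 2) (Fin 2 ⊕ Fin 2) (ZMod 2)) := by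
  have h3 : jacobiSym 2 p = -1 := jacobiSym_two_eq_neg_one (Or.inr hp8)
  have h4 : jacobiSym (-1) p = 1 := jacobiSym_neg_one_eq_one (by omega)
  have h5 : jacobiSym 2 q = 1 := jacobiSym_two_eq_one (Or.inr hq8)
  have h6 : jacobiSym (-1) q = -1 := DeuringLadic.jacobiSym_neg_one_of_mod_four (by omega)
  have h7 : jacobiSym (p : ℤ) p = 0 := Families.jacobiSym_self hp.one_lt
  have h8 : jacobiSym (q : ℤ) q = 0 := Families.jacobiSym_self hq.one_lt
  have h1 : jacobiSym (q : ℤ) p = 1 :=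
    jacobiSym_swap_two_mul_five_mul_plus hq (by omega) (by omega) hpq
  ext i j
  rcases i with i | i <;> rcases j with j | j <;> fin_cases i <;> fin_cases j <;>
    (simp [monskyMatrixEven, legendreMatrix, legendreDiagonal, addLegendreSym, Matrix.fromBlocks,
      Matrix.diagonal, Matrix.transpose, Finset.sum_erase_eq_sub, Fin.sum_univ_succ, h1, hpq, h3, h4,
      h5, h6, h7, h8]; try decide)

/-- **`s(2pq) = 1` on the `(p/q) = +1` half is a THEOREM**: kernel `{0, (0,1,0,1)}` for `q ≡ 3`,
`{0, (0,1,0,0)}` for `q ≡ 7 (mod 8)` (`decide`).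
[cite: HeathBrown1994SelmerCongruentII, Appendix (Monsky), typescript p. 41 L36] -/
theorem monskySelmerRankEven_two_mul_five_mul_plus (hp : p.Prime) (hq : q.Prime) (hp8 : p % 8 = 5)
    (hq4 : q % 4 = 3) (hpq : jacobiSym (p : ℤ) q = 1) : monskySelmerRankEven ![p, q] = 1 := by
  rw [monskySelmerRankEven_eq_one_iff_card_ker]
  rcases (by omega : q % 8 = 3 ∨ q % 8 = 7) with hq8 | hq8
  · rw [monskyMatrixEven_two_mul_five_three_plus hp hq hp8 hq8 hpq]; decide
  · rw [monskyMatrixEven_two_mul_five_seven_plus hp hq hp8 hq8 hpq]; decide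

/-- **`s(2pq) = 1` for EVERY `p ≡ 5 (mod 8)`, `q ≡ 3 (mod 4)`** (both symbol halves; no named fact).
[cite: HeathBrown1994SelmerCongruentII, Appendix (Monsky), typescript p. 41 L36] -/
theorem monskySelmerRankEven_two_mul_five_mul_any (hp : p.Prime) (hq : q.Prime) (hp8 : p % 8 = 5)
    (hq4 : q % 4 = 3) : monskySelmerRankEven ![p, q] = 1 := by
  have hne : p ≠ q := fun h => by omega
  rcases jacobiSym.eq_one_or_neg_one (int_gcd_eq_one_of_primes hp hq hne) with hj | hj
  · exact monskySelmerRankEven_two_mul_five_mul_plus hp hq hp8 hq4 hj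
  · exact monskySelmerRankEven_two_mul_five_mul hp hq hp8 hq4 hj

/-- **`#Sel₂(E_{2pq}) = 8` for EVERY `p ≡ 5 (mod 8)`, `q ≡ 3 (mod 4)`, from Monsky's even formula alone.**
[cite: HeathBrown1994SelmerCongruentII, §1 (typescript p. 1 L14–L20), Appendix (Monsky) p. 41 L20–L36] -/
theorem card_selmerGroup_two_two_mul_five_mul_any (hMe : monsky_card_selmerGroup_two_even)
    (hp : p.Prime) (hq : q.Prime) (hp8 : p % 8 = 5) (hq4 : q % 4 = 3) :
    Nat.card ((congruentNumberCurve (2 * (p * q))).selmerGroup 2) = 8 := by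
  have hne : p ≠ q := fun h => by omega
  have hP : ∀ i, (![p, q] i).Prime := fun i => by fin_cases i <;> assumption
  have hodd : ∀ i, Odd (![p, q] i) := fun i => by
    fin_cases i
    · exact hp.odd_of_ne_two (by omega)
    · exact hq.odd_of_ne_two (by omega)
  have h := hMe 2 ![p, q] hP hodd (injective_vecPair hne)
  rw [monskySelmerRankEven_two_mul_five_mul_any hp hq hp8 hq4] at h
  have hprod : 2 * ∏ i, ![p, q] i = 2 * (p * q) := by simp [Fin.prod_univ_two]
  have key := congrArg (fun n : ℕ => Nat.card ((congruentNumberCurve n).selmerGroup 2)) hprod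
  exact key.symm.trans (h.trans (by norm_num))

end PlusMatrix

/-! ## §2 The `𝒮⁺` door with `hMe` in place of `h515` -/

/-- **THE EVEN HALF-FAMILY `2·p₅·q`, `q ≡ 3 (mod 4)`, `(p/q) = +1`, U⁺ DISCHARGED — Monsky 1994 form.**
`P2.bsdp_two_congruentNumberCurve_two_mul_five_mul` with `h515` replaced by `hMe`: rank `1` from `hGZK`
(`ord_{s=1} L = 1` by U⁺), `#Sel₂ = 8` from §1, `Ш[2^∞] = 0` from the descent count, then the fact-free door.
Modulo `hTYZ` (TYZ §3), `hGZK`, `hR` (Rédei–Reichardt), `hMe` (Heath-Brown 1994 appendix); nothing per-curve.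
[cite: TianYuanZhang2017, Thm. 1.2, Thm. 3.5 and §1 (1.1)] [cite: HeathBrown1994SelmerCongruentII, Appendix (Monsky), typescript p. 41 L20–L36]
[cite: SilvermanAEC2009, Thm. X.4.2] [cite: Miller2011LMS, Def. 1.1 (arXiv:1010.2431 p. 3)] -/
theorem bsdp_two_congruentNumberCurve_two_mul_five_mul_of_monskyEven
    (hTYZ : tyz_genusPointData) (hGZK : rank_eq_analyticRank_of_analyticRank_le_one)
    (hR : redeiReichardt_fourTwoCard_classGroup) (hMe : monsky_card_selmerGroup_two_even)
    {p q : ℕ} (hp : p.Prime) (hq : q.Prime) (hp5 : p % 8 = 5) (hq4 : q % 4 = 3) (hj : jacobiSym p q = 1) :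
    haveI := isElliptic_congruentNumberCurve
      (Nat.mul_ne_zero two_ne_zero (Nat.mul_ne_zero hp.ne_zero hq.ne_zero))
    (congruentNumberCurve (2 * (p * q))).analyticRank = 1 ∧ BSDp (congruentNumberCurve (2 * (p * q))) 2 := by
  have hp2 : p ≠ 2 := by omega
  have hq2 : q ≠ 2 := by omega
  have hne : p ≠ q := fun h => by omega
  obtain ⟨hN, -, -, -⟩ := isCor515Family_two_mul_five_mul hp hq hp5 hq4
  haveI := isElliptic_congruentNumberCurve hN.ne_zero
  haveI : Fact (Nat.Prime 2) := ⟨Nat.prime_two⟩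
  have hsq : Squarefree (2 * (p * q)) := hN.squarefree
  have h6 : (2 * (p * q)) % 8 = 6 := by
    have : (p * q) % 4 = 3 := by rw [Nat.mul_mod, show p % 4 = 1 by omega, hq4]
    omega
  -- U⁺ + `Σ₂′` odd: `𝓛` odd, `ord = 1`, `L′ = 2^e · 𝓛² · Ω · Reg`
  obtain ⟨Lz, hLodd, hr1, hderiv⟩ := rankOneDatum_of_uPlus_six (uPlus_of_genusPointData hTYZ hGZK) hsq h6
    (odd_genusSum₂'_genusField_two_mul_five_mul hR hp hq hp5 hq4 hj)
  have hx : deriv (congruentNumberCurve (2 * (p * q))).entireLFunction 1 =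
      (((2 : ℚ) ^ twoExponent (2 * (p * q)) * (Lz : ℚ) ^ 2 : ℚ) : ℂ) *
        ((congruentNumberCurve (2 * (p * q))).realPeriodRat : ℂ) *
          ((congruentNumberCurve (2 * (p * q))).regulator : ℂ) := by
    rw [hderiv]; push_cast; ring
  have hx0 : (2 : ℚ) ^ twoExponent (2 * (p * q)) * (Lz : ℚ) ^ 2 ≠ 0 := by
    have hL0' : Lz ≠ 0 := fun h => by simp [h] at hLodd
    have hL0 : (Lz : ℚ) ≠ 0 := by exact_mod_cast hL0'
    exact mul_ne_zero (zpow_ne_zero _ two_ne_zero) (pow_ne_zero _ hL0)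
  -- GZK: rank `1`; Monsky's formula + the kernel count: `#Sel₂ = 8`; hence `Ш[2^∞] = 0`
  obtain ⟨hrank, -⟩ := hGZK (congruentNumberCurve (2 * (p * q))) (le_of_eq hr1)
  rw [hr1] at hrank
  have hsel := card_selmerGroup_two_two_mul_five_mul_any hMe hp hq hp5 hq4
  have hbot := primaryComponent_sha_two_eq_bot_of_card_selmerGroup_eq_eight hN.ne_zero hrank hsel
  obtain ⟨he, htam⟩ := twoExponent_tamagawa_two_mul_prime_mul hp hq hp2 hq2 hne
  obtain ⟨-, hiff⟩ := bsdp_two_congruentNumberCurve_iff_of_rank_one_of_sha_two_eq_bot hN hrank hbot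
    (torsionOrder_congruentNumberCurve hsq) hx0 hx
  refine ⟨hr1, hiff.mpr ?_⟩
  rw [padicValRat_two_zpow_mul_sq hLodd, he, htam, padicValNat.prime_pow]
  norm_num

/-- **`BSD(E_{2pq}, 2)` for ALL primes `p ≡ 5 (mod 8)`, `q ≡ 3 (mod 4)` with `(p/q) = +1`**, modulo
`hTYZ`, `hGZK`, `hR`, `hMe` (no Monsky 1990 binder).
[cite: TianYuanZhang2017, Thm. 1.2, Thm. 3.5 and §1 (1.1)] [cite: HeathBrown1994SelmerCongruentII, Appendix (Monsky), typescript p. 41 L20–L36]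
[cite: Miller2011LMS, Def. 1.1 (arXiv:1010.2431 p. 3)] -/
theorem forall_bsdp_two_congruentNumberCurve_two_mul_five_mul_of_monskyEven
    (hTYZ : tyz_genusPointData) (hGZK : rank_eq_analyticRank_of_analyticRank_le_one)
    (hR : redeiReichardt_fourTwoCard_classGroup) (hMe : monsky_card_selmerGroup_two_even) :
    ∀ p q : ℕ, p.Prime → q.Prime → p % 8 = 5 → q % 4 = 3 → jacobiSym p q = 1 →
      BSDp (congruentNumberCurve (2 * (p * q))) 2 :=
  fun _ _ hp hq hp5 hq4 hj =>
    (bsdp_two_congruentNumberCurve_two_mul_five_mul_of_monskyEven hTYZ hGZK hR hMe hp hq hp5 hq4 hj).2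

/-! ## §3 Both halves, modulo `{hTYZ, hGZK, hR, hMe}` and the conjecture as a hypothesis -/

/-- **C-P2-1 is exactly the missing half — Monsky 1994 form.** Granted `hTYZ`, `hGZK`, `hR`, `hMe` and
the conjecture `CongruentSilentEvenFiveBSDTwo` as a HYPOTHESIS: `BSD(E_{2pq}, 2)` for ALL primes
`p ≡ 5 (mod 8)`, `q ≡ 3 (mod 4)` — the symbol `(p/q) ∈ {±1}` splits the family into §2 and `𝒮⁻`.
The `h515`-free twin of `Conjectures.forall_bsdp_two_congruentNumberCurve_two_mul_five_mul_of_conjecture`;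
the conclusion is CONDITIONAL on an OPEN conjecture and asserts nothing.
[cite: TianYuanZhang2017, Thm. 1.2, Thm. 3.5 and §1 (1.1)] [cite: HeathBrown1994SelmerCongruentII, Appendix (Monsky), typescript p. 41 L20–L36]
[cite: Miller2011LMS, Def. 1.1 (arXiv:1010.2431 p. 3)] -/
theorem forall_bsdp_two_congruentNumberCurve_two_mul_five_mul_of_conjecture_of_monskyEven
    (hTYZ : tyz_genusPointData) (hGZK : rank_eq_analyticRank_of_analyticRank_le_one)
    (hR : redeiReichardt_fourTwoCard_classGroup) (hMe : monsky_card_selmerGroup_two_even)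
    (h : CongruentSilentEvenFiveBSDTwo) :
    ∀ p q : ℕ, p.Prime → q.Prime → p % 8 = 5 → q % 4 = 3 →
      BSDp (congruentNumberCurve (2 * (p * q))) 2 := by
  intro p q hp hq hp5 hq4
  have hne : p ≠ q := fun h => by omega
  rcases jacobiSym.eq_one_or_neg_one (int_gcd_eq_one_of_primes hp hq hne) with hj | hj
  · exact forall_bsdp_two_congruentNumberCurve_two_mul_five_mul_of_monskyEven hTYZ hGZK hR hMe p q hp hq
      hp5 hq4 hj
  · exact (h p q hp hq hp5 hq4 hj).2

end Summit.BirchSwinnertonDyer.Rank1Residual.P2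

end
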